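import Summits.Ventures.PercRepro.ProfileFlatUpset

/-!
# PercRepro — (G) AT EVERY RANK-THRESHOLD UP-SET OF FLATS (a kernel instance, termwise)
(p10, gen 18; `proofs/P10-AVFULL.md` §26(a))

For a finite matroid `M` and a threshold `t`, the flats of rank `≥ t` form an up-set `thresholdFlats M t`
(`upFlats_threshold`).  A bi-independent `Z` separated by it has `#Z = rk (cl Z) ≥ t > rk (cl (E ∖ Z)) = #(E ∖ Z)`,
so every term `2 #Z − N − 1 = #Z − #(E ∖ Z) − 1` of the conjecture (G) (`FlatUpsetLimit`, NOT asserted) is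
non-negative: `sum_sepSets_threshold_nonneg`.  The trivial regime of (G); the content of (G) lies in the up-sets
whose minimal members and maximal non-members have INCOMPARABLE ranks (§26(a)).  Nothing here asserts (G).
-/

open scoped Matroid

namespace PercRepro.Cogirth

open Finset ThmH Skew

variable {α : Type} [DecidableEq α] {M : Matroid α} [M.Finite]

open scoped Classical in
/-- The flats of rank at least `t`. -/
noncomputable def thresholdFlats (M : Matroid α) [M.Finite] (t : ℕ) : Finset (Finset α) :=
  (gr M).powerset.filter (fun F => IsFlatF M F ∧ t ≤ rk M F)

open scoped Classical in
omit [DecidableEq α] in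
/-- Membership in `thresholdFlats`. -/
theorem mem_thresholdFlats {t : ℕ} {F : Finset α} :
    F ∈ thresholdFlats M t ↔ F ⊆ gr M ∧ IsFlatF M F ∧ t ≤ rk M F := by
  unfold thresholdFlats
  rw [mem_filter, mem_powerset]

omit [DecidableEq α] in
/-- The rank of the closure is the rank. -/
theorem rk_clF_eq_fu (X : Finset α) : rk M (clF M X) = rk M X := by
  unfold rk
  rw [coe_clF, Matroid.eRk_closure_eq]

omit [DecidableEq α] in
/-- The rank is monotone. -/
theorem rk_mono_fu {X Y : Finset α} (h : X ⊆ Y) : rk M X ≤ rk M Y := by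
  unfold rk
  have h1 : M.eRk (X : Set α) ≤ M.eRk (Y : Set α) := M.eRk_mono (coe_subset.2 h)
  obtain ⟨a, ha, _⟩ := eRk_eq_nat M X
  obtain ⟨b, hb, _⟩ := eRk_eq_nat M Y
  rw [ha, hb] at h1 ⊢
  simp only [ENat.toNat_coe]
  exact_mod_cast h1

omit [DecidableEq α] in
/-- The rank-threshold family is an up-set of flats. -/
theorem upFlats_threshold (t : ℕ) : UpFlats M (thresholdFlats M t) where
  flat := fun F hF => (mem_thresholdFlats.1 hF).2.1
  up := by
    intro F hF G hG hFG
    rw [mem_thresholdFlats] at hF ⊢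
    exact ⟨hG.1, hG, hF.2.2.trans (rk_mono_fu hFG)⟩

/-- A set separated by the rank-threshold family has at least `t` elements, its complement fewer. -/
theorem card_of_mem_sepSets_threshold {t : ℕ} {Z : Finset α} (hZ : Z ∈ sepSets M (thresholdFlats M t)) :
    t ≤ Z.card ∧ (gr M \ Z).card < t := by
  rw [mem_sepSets, mem_biIndepAll] at hZ
  obtain ⟨⟨hZg, hZr, hZc⟩, hin, hout⟩ := hZ
  rw [mem_thresholdFlats, rk_clF_eq_fu, hZr] at hin
  rw [mem_thresholdFlats, rk_clF_eq_fu, hZc] at hout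
  refine ⟨hin.2.2, ?_⟩
  by_contra hcon
  exact hout ⟨clF_subset_gr_fu _, isFlatF_clF _, Nat.le_of_not_lt hcon⟩

/-- **(G) AT EVERY RANK THRESHOLD**: the signed sum over the sets separated by `thresholdFlats M t` is a sum of
non-negative terms. -/
theorem sum_sepSets_threshold_nonneg (t : ℕ) :
    0 ≤ ∑ Z ∈ sepSets M (thresholdFlats M t), (2 * (Z.card : ℤ) - (gr M).card - 1) := by
  apply sum_nonneg
  intro Z hZ
  obtain ⟨h1, h2⟩ := card_of_mem_sepSets_threshold hZ
  have hZg : Z ⊆ gr M := (mem_biIndepAll.1 (mem_sepSets.1 hZ).1).1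
  have hN : (gr M).card = Z.card + (gr M \ Z).card := by
    have hle := card_le_card hZg
    rw [card_sdiff_of_subset hZg]
    omega
  have hN' : ((gr M).card : ℤ) = Z.card + (gr M \ Z).card := by exact_mod_cast hN
  have h1' : (t : ℤ) ≤ Z.card := by exact_mod_cast h1
  have h2' : ((gr M \ Z).card : ℤ) < t := by exact_mod_cast h2
  linarith

end PercRepro.Cogirth
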